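import Mathlib
import HarnessLib
import Summits.NavierStokesRegularity.NavierStokesRegularity.Theorems.HalfSpaceWindowDoorCirculationCarryingRigidityAxisTypeILiouville
import Summits.NavierStokesRegularity.NavierStokesRegularity.Theorems.HalfSpaceWindowDoorCirculationCarryingRigidityCriticalStretchingAnalytic
import Summits.NavierStokesRegularity.NavierStokesRegularity.Theorems.PoloidalWindowDoorPoloidalWindowRigidityForwardSmallness

/-!
# Route `HalfSpaceWindowDoor`, crux `CirculationCarryingRigidity` (stmt-NavierStokesRegularity-25311) — census theorem,
# FAR-PAST form: hypotheses in the far past `t < s₁` suffice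

A Liouville theorem should only need far-past information, and it does: if the TIME-SHIFT `τ ↦ v(τ + s₁)` (`s₁ ≤ 0`) of a
door-class profile satisfies the hypotheses of `…AxisTypeILiouville.eq_zero_of_axisTypeI_signE3_globalCone` — i.e. for times
`t < s₁` the profile obeys the axis-Type-I bound with apex `s₁` (`‖v(t,x)‖ ≤ D/(|x_h| + √(s₁ − t))`, WEAKER than the apex-`0`
bound), is closed-hemisphere and tilt-dominated about the vertical axis — then `v ≡ 0` on the whole slab: the shifted profile
is a door-class profile (g2's `timeShift_class`), so it vanishes, so `v = 0` for `t < s₁`, and a door-class profile vanishing at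
arbitrarily early times vanishes identically (K2's `eq_zero_of_frequently_small`).  Census row for crux 25311: «EVENTUALLY (in the
far past) tilt-dominated + axis-Type-I closed-hemisphere profiles are trivial».

Seat ns-hsw-p1 g3 (LEAD of 25311, cell pub-ns-dss).  WHAT THIS IS NOT: not a statement about Navier–Stokes regularity;
HYPOTHETICAL blow-up profiles; helper `--supports` 25311.
-/

noncomputable section

-- the summit and its single sub-problem share the name (CONVENTIONS §1), as in every Theorems file
set_option linter.dupNamespace false

namespace Summit.NavierStokesRegularity.NavierStokesRegularity.Theorems.HalfSpaceWindowDoorCirculationCarryingRigidityFarPastTiltLiouville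

open MeasureTheory Set Function Filter Topology TopologicalSpace InnerProductSpace WithLp Metric
open scoped RealInnerProductSpace ContDiff
open Literature.Analysis Literature.Analysis.FluidPDE Literature.Analysis.UnboundedOperators
open Summit.NavierStokesRegularity.NavierStokesRegularity.Theorems.AxisTwistDoorAveragedConeLiouvilleDefs (SignE3 GlobalCone)
open Summit.NavierStokesRegularity.NavierStokesRegularity.Theorems.HalfSpaceWindowDoorCirculationCarryingRigidityAxisTypeILiouville
  (eq_zero_of_axisTypeI_signE3_globalCone)
open Summit.NavierStokesRegularity.NavierStokesRegularity.Theorems.HalfSpaceWindowDoorCirculationCarryingRigidityCriticalStretchingAnalytic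
  (timeShift_class)
open Summit.NavierStokesRegularity.NavierStokesRegularity.Theorems.PoloidalWindowDoorPoloidalWindowRigidityForwardSmallness
  (eq_zero_of_frequently_small)

/-- **FAR-PAST FORM OF THE CENSUS THEOREM.**  Let `v` be a profile of the door's Type-I ancient Oseen-mild class and `s₁ ≤ 0`.
If its time-shift `w(τ) = v(τ + s₁)` obeys the axis-Type-I bound `‖w(τ,x)‖ ≤ D/(|x_h| + √(−τ))` (that is,
`‖v(t,x)‖ ≤ D/(|x_h| + √(s₁ − t))` for `t < s₁`), the closed-hemisphere sign and the slack-free circle-averaged cone about the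
vertical axis (all three only involve `v` at times `< s₁`), then `v ≡ 0` on the whole open slab. -/
theorem eq_zero_of_farPast_axisTypeI_signE3_globalCone (C D : ℝ)
    (v : ℝ → EuclideanSpace ℝ (Fin 3) → EuclideanSpace ℝ (Fin 3))
    (hrate : HasTypeITimeDecay C v)
    (hcont : ContinuousOn (uncurry v) (Iio (0 : ℝ) ×ˢ univ))
    (hmild : ∀ s t : ℝ, s < t → t < 0 → ∀ x, v t x = heatExtension (v s) (t - s) x - oseenDuhamel 1 s v v t x)
    (hdiv : ∀ t < 0, VectorCalculus.IsDivFree (v t)) {s₁ : ℝ} (hs₁ : s₁ ≤ 0)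
    (hDax : ∀ τ < 0, ∀ x : EuclideanSpace ℝ (Fin 3), ‖v (τ + s₁) x‖ ≤ D / (cylRadius x + Real.sqrt (-τ)))
    (hsign : SignE3 (fun τ => v (τ + s₁))) (hcone : GlobalCone (fun τ => v (τ + s₁))) :
    ∀ t < 0, ∀ x, v t x = 0 := by
  -- the shifted profile is a door-class profile and satisfies the census hypotheses, hence vanishes
  obtain ⟨hrate', hcont', hmild', hdiv'⟩ := timeShift_class hrate hcont hmild hdiv hs₁
  have hw : ∀ τ < 0, ∀ x, (fun τ => v (τ + s₁)) τ x = 0 :=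
    eq_zero_of_axisTypeI_signE3_globalCone C D (fun τ => v (τ + s₁)) hrate' hcont' hmild' hdiv' hDax hsign hcone
  -- so `v = 0` at all times `< s₁`, in particular frequently in the far past
  have hv : ∀ t < s₁, ∀ x, v t x = 0 := by
    intro t ht x
    have h := hw (t - s₁) (by linarith) x
    simpa using h
  refine eq_zero_of_frequently_small hrate hmild fun ε hε T => ?_
  refine ⟨min T s₁ - 1, by linarith [min_le_left T s₁], fun x => ?_⟩
  rw [hv _ (by linarith [min_le_right T s₁]) x, norm_zero, mul_zero]
  exact hε.le

end Summit.NavierStokesRegularity.NavierStokesRegularity.Theorems.HalfSpaceWindowDoorCirculationCarryingRigidityFarPastTiltLiouville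

end
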